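import Summits.NavierStokesRegularity.NavierStokesRegularity.Theorems.ContinuousAlignmentAprioriContinuousAlignmentStubRegularAligned
import Summits.NavierStokesRegularity.NavierStokesRegularity.Theses.ScaledTopAlignment
import Summits.NavierStokesRegularity.NavierStokesRegularity.Theses.ContinuousAlignment
import Literature.Analysis.FluidPDE.GigaMiura2011BlowupAnalysis
import HarnessLib

/-!
# Route `ScaledTopAlignment`: the BC5 rungs of the door W3 = `AprioriScaledTopAlignment`
# (stmt-NavierStokesRegularity-19901) — W3 below (CA), below W1, and at near-maximum points below (CA′)

The door W3 of route `ScaledTopAlignment` (planner p3, cell ns-regularity-ideate ROUND-2) asks, for a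
classical Leray–Hopf solution, that above a vorticity level `M(λ, R, ε)` the `λ`-top vorticity set be
unidirectional UP TO SIGN (direction sine `≤ ε`) within `R` diffusion lengths `√(ν/|ω(x)|)` of each top
point. Route.md «Why this line» / BC5 places W3 against the printed direction-coherence hypotheses; this
file records those placements as kernel theorems (no new definitions; W3's conclusion and the
hypotheses are written out):

* `scaledTopSine_le_of_sineCoherent` — the lever: `t`-uniform sine coherence of the direction on a
  FIXED level set `{|ω| > d}` at some scale `δ(ε)` implies W3's conclusion, with the explicit threshold
  `M = (d+1)/λ + (d+1) + 4νR²/δ²` (above `M` both points are above `d` and the amplitude radius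
  `R√(ν/|ω(x)|)` is below `δ/2`);
* `scaledTopSine_le_of_chordModulus` and **`scaledTopAlignmentAt_of_continuousAlignmentAt`** — the
  route's registered BC5 rung (cell file `W3Rung.lean`, `NsregP3.W3Rung.w3At_of_caAt`, referee PASS):
  the Constantin–Fefferman / Giga–Miura FIXED-modulus hypothesis (CA) at ONE solution (signed chord
  form, any modulus `η → 0` at `0⁺`) implies W3's conclusion at that solution for all `λ ∈ (0,1)`,
  `R > 0`, `ε > 0` — so W3 lies below (CA) [CF93 §1; GM11 Thm 1.1 / (CA)];
* **`aprioriScaledTopAlignment_of_aprioriContinuousAlignment`** — BY NAME: the residual crux W1 =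
  `ContinuousAlignment.AprioriContinuousAlignment` of the tree's (dormant) route `ContinuousAlignment`
  (stmt-NavierStokesRegularity-18585) implies W3 = `ScaledTopAlignment.AprioriScaledTopAlignment`
  (Route.md: "W1 ⇒ W3 is proved (`scaledTopAlignment_of_aprioriContinuousAlignment`) and W3 is strictly
  weaker");
* **`scaledTopSine_le_nearMax_of_scaledAlignment`** — Route.md's fallback rung
  `stub_rung_W3_nearmax_CAprime`, now kernel: under Giga–Miura's PARABOLICALLY SCALED modulus (CA′)
  (`HasScaledContinuousAlignment`, Remark 1.4) and the vorticity rate ceiling `|ω(t,x)| ≤ K/(T − t)`,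
  W3's conclusion holds at the NEAR-MAXIMUM points `|ω(t,x)| ≥ κ/(T − t)` (there the amplitude radius
  `R√(ν/|ω(x)|)` is at most `R/√κ` similarity radii `√(ν(T−t))`, where (CA′)'s argument is `o(1)`).

With `gigaMiura2011_scaledAlignment_typeI_holds` / `gigaMiura_continuousAlignment_typeI_holds`
(`ScaledTopAlignmentGigaMiuraTypeI.lean`) the comparison statements (CA), (CA′) are themselves tree
theorems under Type I. WHAT THIS IS NOT: none of this proves W3; these are the dominated-side rungs
(BC5 witnesses) of the door.

## References

* P. Constantin, C. Fefferman, Indiana Univ. Math. J. 42 (1993) 775–789, §1. [ConstantinFefferman1993]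
* Y. Giga, H. Miura, Comm. Math. Phys. 303 (2011) 289–300 = HUPS #956: Thm 1.1, Rmk 1.4 (CA′)
  (pp. 3–4), §2.1 (pp. 5–9). [GigaMiura2011]
-/

noncomputable section

-- the summit and its single sub-problem share the name (CONVENTIONS §1), as in every Theorems file
set_option linter.dupNamespace false

open Set Function Filter Topology
open scoped RealInnerProductSpace

namespace Summit.NavierStokesRegularity.NavierStokesRegularity.Theorems

open Literature.Analysis Literature.Analysis.FluidPDE

/-! ### The lever: fixed-level sine coherence at some scale gives W3's conclusion -/

/-- **Fixed-level sine coherence implies scaled top-set alignment (the lever of the BC5 rungs).** Let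
`ω : ℝ → ℝ³ → ℝ³` and a level `d > 0` be such that for every `ε > 0` there is `δ > 0` with
`sin∠(ω(t,x), ω(t,y)) ≤ ε` whenever `t ∈ S`, `|ω(t,x)|, |ω(t,y)| > d` and `|x − y| < δ`. Then for all
`λ > 0`, `R > 0`, `ε > 0` there is `M > 0` (namely `(d+1)/λ + (d+1) + 4νR²/δ(ε)²`) such that for `t ∈ S`,
`|ω(t,x)| ≥ M`, `λ|ω(t,x)| ≤ |ω(t,y)|` and `|x − y| ≤ R√(ν/|ω(t,x)|)` the sine is `≤ ε`: above `M`
both points are above the level `d` and the amplitude radius is below `δ/2`. [folklore] -/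
theorem scaledTopSine_le_of_sineCoherent {ν : ℝ} (hν : 0 < ν) {S : Set ℝ}
    {ω : ℝ → EuclideanSpace ℝ (Fin 3) → EuclideanSpace ℝ (Fin 3)} {d : ℝ} (hd : 0 < d)
    (hcoh : ∀ ε : ℝ, 0 < ε → ∃ δ : ℝ, 0 < δ ∧ ∀ t ∈ S, ∀ x y : EuclideanSpace ℝ (Fin 3),
      d < ‖ω t x‖ → d < ‖ω t y‖ → ‖x - y‖ < δ →
        Real.sqrt (1 - (inner ℝ (‖ω t x‖⁻¹ • ω t x) (‖ω t y‖⁻¹ • ω t y)) ^ 2) ≤ ε)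
    {lam R ε : ℝ} (hlam : 0 < lam) (hR : 0 < R) (hε : 0 < ε) :
    ∃ M : ℝ, 0 < M ∧ ∀ t ∈ S, ∀ x y : EuclideanSpace ℝ (Fin 3),
      M ≤ ‖ω t x‖ → lam * ‖ω t x‖ ≤ ‖ω t y‖ → ‖x - y‖ ≤ R * Real.sqrt (ν / ‖ω t x‖) →
        Real.sqrt (1 - (inner ℝ (‖ω t x‖⁻¹ • ω t x) (‖ω t y‖⁻¹ • ω t y)) ^ 2) ≤ ε := by
  -- adapted from the cell file ns-regularity-ideate-p3/W3Rung.lean (NsregP3.W3Rung.w3At_of_caAt)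
  obtain ⟨δ, hδ, hδε⟩ := hcoh ε hε
  have hA : 0 < 4 * ν * R ^ 2 / δ ^ 2 := by positivity
  have hdl : 0 < (d + 1) / lam := by positivity
  refine ⟨(d + 1) / lam + (d + 1) + 4 * ν * R ^ 2 / δ ^ 2, by positivity, ?_⟩
  intro t ht x y hMx hlamy hxy
  set a := ‖ω t x‖ with ha
  set b := ‖ω t y‖ with hb
  -- both points are above the level `d`
  have hxd : d < a := by linarith
  have hyd : d < b := by
    have h1 : lam * ((d + 1) / lam + (d + 1) + 4 * ν * R ^ 2 / δ ^ 2) ≤ lam * a :=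
      mul_le_mul_of_nonneg_left hMx hlam.le
    have e : lam * ((d + 1) / lam + (d + 1) + 4 * ν * R ^ 2 / δ ^ 2)
        = d + 1 + lam * ((d + 1) + 4 * ν * R ^ 2 / δ ^ 2) := by
      field_simp
      ring
    rw [e] at h1
    have h2 : 0 ≤ lam * ((d + 1) + 4 * ν * R ^ 2 / δ ^ 2) := by positivity
    have h3 : lam * a ≤ b := hlamy
    linarith
  have ha0 : 0 < a := hd.trans hxd
  -- the amplitude radius is below `δ`
  have hrad : ‖x - y‖ < δ := by
    have hMa : 4 * ν * R ^ 2 / δ ^ 2 ≤ a := by linarith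
    have hq : ν / a ≤ (δ / (2 * R)) ^ 2 := by
      rw [div_le_iff₀ ha0]
      have h1 : 4 * ν * R ^ 2 ≤ a * δ ^ 2 := by
        have := (div_le_iff₀ (by positivity : (0:ℝ) < δ ^ 2)).1 hMa
        linarith
      have e : (δ / (2 * R)) ^ 2 * a = a * δ ^ 2 / (4 * R ^ 2) := by
        field_simp
        ring
      rw [e, le_div_iff₀ (by positivity)]
      nlinarith
    have hs : Real.sqrt (ν / a) ≤ δ / (2 * R) := by
      calc Real.sqrt (ν / a) ≤ Real.sqrt ((δ / (2 * R)) ^ 2) := Real.sqrt_le_sqrt hq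
        _ = δ / (2 * R) := Real.sqrt_sq (by positivity)
    have h2 : R * Real.sqrt (ν / a) ≤ δ / 2 := by
      calc R * Real.sqrt (ν / a) ≤ R * (δ / (2 * R)) := mul_le_mul_of_nonneg_left hs hR.le
        _ = δ / 2 := by field_simp
    linarith
  exact hδε t ht x y hxd hyd hrad

/-! ### W3 below the fixed-modulus continuous alignment (CA) -/

/-- **A chord modulus of the direction gives sine coherence, hence W3's conclusion.** If on the level
set `{|ω| > d}` (`t ∈ S`) the direction `ξ = ω/|ω|` has a chord modulus `‖ξ(t,x) − ξ(t,y)‖ ≤ η(|x − y|)`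
(`x ≠ y`) with `η(s) → 0` as `s → 0⁺` — the Constantin–Fefferman (`η(s) = s/ρ`) / Giga–Miura (CA)
hypothesis —, then W3's conclusion holds over `S` for all `λ > 0`, `R > 0`, `ε > 0` (sine `≤` chord for
unit vectors, `sqrt_one_sub_inner_sq_le_norm_sub`, then `scaledTopSine_le_of_sineCoherent`).
[cite: GigaMiura2011, Thm 1.1 with condition (CA) (§1; HUPS preprint #956 p. 3)] -/
theorem scaledTopSine_le_of_chordModulus {ν : ℝ} (hν : 0 < ν) {S : Set ℝ}
    {ω : ℝ → EuclideanSpace ℝ (Fin 3) → EuclideanSpace ℝ (Fin 3)}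
    (hCA : ∃ d : ℝ, 0 < d ∧ ∃ η : ℝ → ℝ, Tendsto η (𝓝[>] 0) (𝓝 0) ∧
      ∀ t ∈ S, ∀ x y : EuclideanSpace ℝ (Fin 3), d < ‖ω t x‖ → d < ‖ω t y‖ → x ≠ y →
        ‖(‖ω t x‖⁻¹ • ω t x) - (‖ω t y‖⁻¹ • ω t y)‖ ≤ η ‖x - y‖)
    {lam R ε : ℝ} (hlam : 0 < lam) (hR : 0 < R) (hε : 0 < ε) :
    ∃ M : ℝ, 0 < M ∧ ∀ t ∈ S, ∀ x y : EuclideanSpace ℝ (Fin 3),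
      M ≤ ‖ω t x‖ → lam * ‖ω t x‖ ≤ ‖ω t y‖ → ‖x - y‖ ≤ R * Real.sqrt (ν / ‖ω t x‖) →
        Real.sqrt (1 - (inner ℝ (‖ω t x‖⁻¹ • ω t x) (‖ω t y‖⁻¹ • ω t y)) ^ 2) ≤ ε := by
  obtain ⟨d, hd, η, hη, hmod⟩ := hCA
  refine scaledTopSine_le_of_sineCoherent hν hd (fun ε' hε' => ?_) hlam hR hε
  -- the modulus is below `ε'` on a right-neighbourhood `(0, δ)`
  obtain ⟨δ, hδ, hηε⟩ : ∃ δ > 0, ∀ s : ℝ, 0 < s → s < δ → η s < ε' := by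
    obtain ⟨δ, hδ, h⟩ := Metric.tendsto_nhdsWithin_nhds.mp hη ε' hε'
    refine ⟨δ, hδ, fun s hs hsδ => ?_⟩
    have h1 := h (show s ∈ Ioi (0:ℝ) from hs)
      (by rw [dist_zero_right, Real.norm_eq_abs, abs_of_pos hs]; exact hsδ)
    rw [dist_zero_right, Real.norm_eq_abs] at h1
    exact lt_of_abs_lt h1
  refine ⟨δ, hδ, fun t ht x y hxd hyd hxy => ?_⟩
  have hxa : ω t x ≠ 0 := by
    intro h; rw [h, norm_zero] at hxd; linarith
  have hyb : ω t y ≠ 0 := by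
    intro h; rw [h, norm_zero] at hyd; linarith
  have hua : ‖(‖ω t x‖⁻¹ • ω t x)‖ = 1 := norm_smul_inv_norm hxa
  have hub : ‖(‖ω t y‖⁻¹ • ω t y)‖ = 1 := norm_smul_inv_norm hyb
  by_cases hxy0 : x = y
  · -- same point: the sine vanishes
    subst hxy0
    have hself : inner ℝ (‖ω t x‖⁻¹ • ω t x) (‖ω t x‖⁻¹ • ω t x) = 1 := by
      rw [real_inner_self_eq_norm_sq, hua]; norm_num
    rw [hself]; norm_num; exact hε'.le
  · have hpos : 0 < ‖x - y‖ := norm_pos_iff.mpr (sub_ne_zero.mpr hxy0)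
    calc Real.sqrt (1 - (inner ℝ (‖ω t x‖⁻¹ • ω t x) (‖ω t y‖⁻¹ • ω t y)) ^ 2)
        ≤ ‖(‖ω t x‖⁻¹ • ω t x) - (‖ω t y‖⁻¹ • ω t y)‖ :=
          sqrt_one_sub_inner_sq_le_norm_sub _ _ hua hub
      _ ≤ η ‖x - y‖ := hmod t ht x y hxd hyd hxy0
      _ ≤ ε' := (hηε _ hpos hxy).le

/-- **BC5 rung of route `ScaledTopAlignment` (cell file `W3Rung.lean`, `NsregP3.W3Rung.w3At_of_caAt`):
(CA) at a solution implies W3 at that solution.** For `ν > 0` and a velocity field `u` on `[0, T)`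
whose vorticity direction satisfies the FIXED-modulus continuous-alignment hypothesis (CA) on a level
set `{|curl u(t)| > d}`, `t ∈ [0, T)` (signed chord form, any modulus `η → 0` at `0⁺`; Constantin–
Fefferman 1993 has `η(s) = s/ρ`, Giga–Miura 2011 a general modulus), W3's conclusion holds at `u` for
every `λ ∈ (0, 1)`, `R > 0`, `ε > 0`. Hence W3 (for all solutions) lies below (CA) (for all
solutions); regularity under a general modulus (CA) without Type I is not in print (GM11 Thm 1.1 /
`gigaMiura_continuousAlignment_typeI_holds` exclude Type I only), so the rung is outside the summit's
known regime. The hypothesis `λ < 1` of W3 is carried but not used. [cite: GigaMiura2011, Thm 1.1 with condition (CA) (§1; HUPS preprint #956 p. 3)] -/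
theorem scaledTopAlignmentAt_of_continuousAlignmentAt {ν T : ℝ} (hν : 0 < ν)
    {u : ℝ → EuclideanSpace ℝ (Fin 3) → EuclideanSpace ℝ (Fin 3)}
    (hCA : ∃ d : ℝ, 0 < d ∧ ∃ η : ℝ → ℝ, Tendsto η (𝓝[>] 0) (𝓝 0) ∧
      ∀ t ∈ Ico 0 T, ∀ x y : EuclideanSpace ℝ (Fin 3), d < ‖curl (u t) x‖ → d < ‖curl (u t) y‖ →
        x ≠ y → ‖(‖curl (u t) x‖⁻¹ • curl (u t) x) - (‖curl (u t) y‖⁻¹ • curl (u t) y)‖ ≤ η ‖x - y‖)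
    {lam R ε : ℝ} (hlam : 0 < lam) (_hlam1 : lam < 1) (hR : 0 < R) (hε : 0 < ε) :
    ∃ M : ℝ, 0 < M ∧ ∀ t ∈ Ico 0 T, ∀ x y : EuclideanSpace ℝ (Fin 3),
      M ≤ ‖curl (u t) x‖ → lam * ‖curl (u t) x‖ ≤ ‖curl (u t) y‖ →
      ‖x - y‖ ≤ R * Real.sqrt (ν / ‖curl (u t) x‖) →
        Real.sqrt (1 - (inner ℝ (‖curl (u t) x‖⁻¹ • curl (u t) x)
          (‖curl (u t) y‖⁻¹ • curl (u t) y)) ^ 2) ≤ ε :=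
  scaledTopSine_le_of_chordModulus (ω := fun t => curl (u t)) hν hCA hlam hR hε

/-! ### W3 below W1 (a-priori continuous alignment), by name -/

/-- **W1 ⇒ W3, by name.** The residual crux W1 = `AprioriContinuousAlignment` of the tree's route
`ContinuousAlignment` (stmt-NavierStokesRegularity-18585: for every classical Leray–Hopf solution from a
rapidly decaying datum and EVERY level `d > 0`, the vorticity direction is sine-coherent on `{|ω| > d}`
uniformly in `t ∈ [0, T)`) implies the door W3 = `AprioriScaledTopAlignment` of route
`ScaledTopAlignment` (stmt-NavierStokesRegularity-19901): apply the lever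
`scaledTopSine_le_of_sineCoherent` at the level `d = 1`. (Route.md «Why this line»: "W1 ⇒ W3 is proved
and W3 is strictly weaker"; cell file `ScaledTopAlignment.lean`,
`NsregP3.scaledTopAlignment_of_aprioriContinuousAlignment`.) [folklore] -/
theorem aprioriScaledTopAlignment_of_aprioriContinuousAlignment
    (hW1 : Summit.NavierStokesRegularity.NavierStokesRegularity.Theses.ContinuousAlignment.AprioriContinuousAlignment) :
    Summit.NavierStokesRegularity.NavierStokesRegularity.Theses.ScaledTopAlignment.AprioriScaledTopAlignment := by
  intro ν T hν hT u p hsol hLH hdec lam hlam _hlam1 R hR ε hε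
  have hcoh := hW1 ν T hν hT u p hsol hLH hdec 1 one_pos
  exact scaledTopSine_le_of_sineCoherent (ω := fun t => curl (u t)) hν one_pos hcoh hlam hR hε

/-! ### W3 at near-maximum points below the parabolically scaled modulus (CA′) -/

/-- **Route.md's fallback rung `stub_rung_W3_nearmax_CAprime`, kernel form: under (CA′) and the
vorticity rate ceiling, W3's conclusion holds at near-maximum points.** Let `u` satisfy Giga–Miura's
scaled continuous alignment (CA′) = `HasScaledContinuousAlignment ν T u` (Remark 1.4: chord of the
directions `≤ η(θ(t)|x − y|/√(ν(T − t)))` on `{|ω| > d}`, `θ(t) → 0` as `t ↑ T`) and the vorticity rate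
ceiling `|ω(t,x)| ≤ K/(T − t)` on `(0, T)`. Then for all `κ > 0`, `λ > 0`, `R > 0`, `ε > 0` there is
`M > 0` such that for `t ∈ (0, T)` and NEAR-MAXIMUM top points `x` — `|ω(t,x)| ≥ M` and
`|ω(t,x)| ≥ κ/(T − t)` — every `y` with `λ|ω(t,x)| ≤ |ω(t,y)|` and `|x − y| ≤ R√(ν/|ω(t,x)|)` has
direction sine `≤ ε`: the amplitude radius is at most `R/√κ` similarity radii `√(ν(T − t))`, so the
argument of `η` is `≤ θ(t)R/√κ → 0`, and the ceiling turns `|ω(t,x)| ≥ M` into `t` close to `T`. This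
is the near-maximum part of W3 that (CA′) controls (Route.md «Why this line»: W3 and (CA′) are
incomparable; on the profile tails `M ≤ |ω| ≪ ‖ω(t)‖_∞` (CA′) says nothing). [cite: GigaMiura2011, Remark 1.4, condition (CA′) (§1; HUPS preprint #956 p. 4)] -/
theorem scaledTopSine_le_nearMax_of_scaledAlignment {ν T : ℝ} (hν : 0 < ν) (hT : 0 < T)
    {u : ℝ → EuclideanSpace ℝ (Fin 3) → EuclideanSpace ℝ (Fin 3)}
    (hCA : HasScaledContinuousAlignment ν T u) {K : ℝ}
    (hrate : ∀ t ∈ Ioo 0 T, ∀ x, ‖curl (u t) x‖ ≤ K / (T - t))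
    {κ lam R ε : ℝ} (hκ : 0 < κ) (hlam : 0 < lam) (hR : 0 < R) (hε : 0 < ε) :
    ∃ M : ℝ, 0 < M ∧ ∀ t ∈ Ioo 0 T, ∀ x y : EuclideanSpace ℝ (Fin 3),
      M ≤ ‖curl (u t) x‖ → κ / (T - t) ≤ ‖curl (u t) x‖ →
      lam * ‖curl (u t) x‖ ≤ ‖curl (u t) y‖ → ‖x - y‖ ≤ R * Real.sqrt (ν / ‖curl (u t) x‖) →
        Real.sqrt (1 - (inner ℝ (‖curl (u t) x‖⁻¹ • curl (u t) x)
          (‖curl (u t) y‖⁻¹ • curl (u t) y)) ^ 2) ≤ ε := by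
  obtain ⟨d, hd, η, θ, -, hηc, hη0, hθ0, hθ, hmod⟩ := hCA
  -- `η < ε` on `[0, δ₁)`
  obtain ⟨δ₁, hδ₁, hηε⟩ : ∃ δ₁ > 0, ∀ r : ℝ, 0 ≤ r → r < δ₁ → η r < ε := by
    have hcont : ContinuousWithinAt η (Ici 0) 0 := hηc 0 (mem_Ici.2 le_rfl)
    obtain ⟨δ₁, hδ₁, h⟩ := Metric.continuousWithinAt_iff.1 hcont ε hε
    refine ⟨δ₁, hδ₁, fun r hr hrδ => ?_⟩
    have h1 := h (mem_Ici.2 hr) (by rw [dist_zero_right, Real.norm_eq_abs, abs_of_nonneg hr]; exact hrδ)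
    rw [hη0, dist_zero_right, Real.norm_eq_abs] at h1
    exact lt_of_abs_lt h1
  -- `θ(t) R/√κ < δ₁` for `t ∈ (t₀, T)`
  obtain ⟨t₀, ht₀T, hθsmall⟩ : ∃ t₀ < T, ∀ t ∈ Ioo t₀ T, θ t < δ₁ * Real.sqrt κ / R := by
    have hpos : 0 < δ₁ * Real.sqrt κ / R := by
      have := Real.sqrt_pos.2 hκ; positivity
    have hev : ∀ᶠ t in 𝓝[<] T, θ t < δ₁ * Real.sqrt κ / R := hθ.eventually (gt_mem_nhds hpos)
    obtain ⟨t₀, ht₀, h⟩ := mem_nhdsLT_iff_exists_Ioo_subset.1 hev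
    exact ⟨t₀, ht₀, fun t ht => h ht⟩
  -- the threshold: above `M` the time is later than `t₀` (rate ceiling) and both points are above `d`
  set t₁ : ℝ := max t₀ 0 with ht₁
  have ht₁T : 0 < T - t₁ := by
    have : t₁ < T := max_lt ht₀T hT
    linarith
  have hK1 : 0 < |K| + 1 := by positivity
  set A : ℝ := (|K| + 1) / (T - t₁) with hA
  have hApos : 0 < A := div_pos hK1 ht₁T
  set M : ℝ := (d + 1) / lam + (d + 1) + 2 * A with hM
  refine ⟨M, by positivity, ?_⟩
  intro t ht x y hMx hκx hlamy hxy
  set a := ‖curl (u t) x‖ with ha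
  set b := ‖curl (u t) y‖ with hb
  have hTt : 0 < T - t := sub_pos.2 ht.2
  have hdl : 0 < (d + 1) / lam := by positivity
  have ha0 : 0 < a := lt_of_lt_of_le (by positivity) hMx
  -- both points above the level `d`
  have hxd : d < a := by
    have : d + 1 ≤ M := by rw [hM]; linarith
    linarith
  have hyd : d < b := by
    have h1 : lam * M ≤ lam * a := mul_le_mul_of_nonneg_left hMx hlam.le
    have h2 : d + 1 ≤ lam * M := by
      have e : lam * M = d + 1 + lam * ((d + 1) + 2 * A) := by
        rw [hM]
        field_simp
        ring
      rw [e]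
      have : 0 ≤ lam * ((d + 1) + 2 * A) := by positivity
      linarith
    have h3 : lam * a ≤ b := hlamy
    linarith
  -- the time is later than `t₀`: `M ≤ a ≤ K/(T − t)` forces `T − t` small
  have htt₀ : t₀ < t := by
    by_contra hle
    push Not at hle
    have hKle : a ≤ (|K| + 1) / (T - t) := by
      calc a ≤ K / (T - t) := hrate t ht x
        _ ≤ (|K| + 1) / (T - t) := by
            apply div_le_div_of_nonneg_right _ hTt.le
            linarith [le_abs_self K]
    have hmax : T - t₁ ≤ T - t := by
      have : t ≤ t₁ := le_trans hle (le_max_left _ _)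
      linarith
    have h2 : (|K| + 1) / (T - t) ≤ A := div_le_div_of_nonneg_left hK1.le ht₁T hmax
    have h3 : A < M := by rw [hM]; linarith
    linarith
  -- (CA′) at the pair, with argument `≤ θ(t) R/√κ < δ₁`
  have hxa : curl (u t) x ≠ 0 := by
    intro h; rw [ha, h, norm_zero] at ha0; exact lt_irrefl _ ha0
  have hyb : curl (u t) y ≠ 0 := by
    intro h; rw [hb, h, norm_zero] at hyd; linarith
  have hua : ‖(‖curl (u t) x‖⁻¹ • curl (u t) x)‖ = 1 := norm_smul_inv_norm hxa
  have hub : ‖(‖curl (u t) y‖⁻¹ • curl (u t) y)‖ = 1 := norm_smul_inv_norm hyb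
  have hms := hmod t ht x y hxd hyd
  rw [vorticityDirection_apply, vorticityDirection_apply] at hms
  have hsqpos : 0 < Real.sqrt (ν * (T - t)) := Real.sqrt_pos.2 (mul_pos hν hTt)
  have harg0 : 0 ≤ θ t * ‖x - y‖ / Real.sqrt (ν * (T - t)) := by
    have := hθ0 t; positivity
  have harg : θ t * ‖x - y‖ / Real.sqrt (ν * (T - t)) < δ₁ := by
    -- `‖x - y‖ ≤ R √(ν/a)` and `a (T - t) ≥ κ` give `‖x - y‖ / √(ν(T-t)) ≤ R/√κ`
    have h1 : ‖x - y‖ ≤ R * Real.sqrt (ν / a) := hxy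
    have h2 : Real.sqrt (ν / a) ≤ Real.sqrt (ν * (T - t)) / Real.sqrt κ := by
      rw [le_div_iff₀ (Real.sqrt_pos.2 hκ), ← Real.sqrt_mul (div_pos hν ha0).le]
      apply Real.sqrt_le_sqrt
      -- `ν/a · κ ≤ ν (T - t)` iff `κ ≤ a (T - t)`
      have h3 : κ ≤ a * (T - t) := by
        have := (div_le_iff₀ hTt).1 hκx
        linarith
      calc ν / a * κ ≤ ν / a * (a * (T - t)) :=
            mul_le_mul_of_nonneg_left h3 (div_pos hν ha0).le
        _ = ν * (T - t) := by field_simp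
    have h4 : ‖x - y‖ ≤ R * (Real.sqrt (ν * (T - t)) / Real.sqrt κ) :=
      h1.trans (mul_le_mul_of_nonneg_left h2 hR.le)
    have h5 : θ t * ‖x - y‖ / Real.sqrt (ν * (T - t)) ≤ θ t * (R / Real.sqrt κ) := by
      rw [div_le_iff₀ hsqpos]
      have h6 := mul_le_mul_of_nonneg_left h4 (hθ0 t)
      calc θ t * ‖x - y‖ ≤ θ t * (R * (Real.sqrt (ν * (T - t)) / Real.sqrt κ)) := h6
        _ = θ t * (R / Real.sqrt κ) * Real.sqrt (ν * (T - t)) := by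
            field_simp
    have h7 : θ t * (R / Real.sqrt κ) < δ₁ := by
      have h8 := hθsmall t ⟨htt₀, ht.2⟩
      have hsκ : 0 < Real.sqrt κ := Real.sqrt_pos.2 hκ
      rw [lt_div_iff₀ hR] at h8
      calc θ t * (R / Real.sqrt κ) = θ t * R / Real.sqrt κ := by ring
        _ < δ₁ * Real.sqrt κ / Real.sqrt κ := by
            exact div_lt_div_of_pos_right h8 hsκ
        _ = δ₁ := by field_simp
    exact lt_of_le_of_lt h5 h7
  calc Real.sqrt (1 - (inner ℝ (‖curl (u t) x‖⁻¹ • curl (u t) x) (‖curl (u t) y‖⁻¹ • curl (u t) y)) ^ 2)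
      ≤ ‖(‖curl (u t) x‖⁻¹ • curl (u t) x) - (‖curl (u t) y‖⁻¹ • curl (u t) y)‖ :=
        sqrt_one_sub_inner_sq_le_norm_sub _ _ hua hub
    _ ≤ η (θ t * ‖x - y‖ / Real.sqrt (ν * (T - t))) := hms
    _ ≤ ε := (hηε _ harg0 harg).le

end Summit.NavierStokesRegularity.NavierStokesRegularity.Theorems

end
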